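import Mathlib.Topology.Algebra.InfiniteSum.Nonarchimedean
import Mathlib.Topology.Algebra.InfiniteSum.Constructions
import Mathlib.Topology.Algebra.InfiniteSum.NatInt
import Mathlib.Topology.Algebra.InfiniteSum.Ring
import Mathlib.Analysis.Normed.Field.Ultra
import Mathlib.Analysis.Normed.Group.Ultra
import Mathlib.Analysis.Normed.Group.InfiniteSum
import Mathlib.Analysis.SpecificLimits.Normed
import Mathlib.Data.Finset.NatAntidiagonal
import Mathlib.Algebra.Ring.GeomSum
import HarnessLib

/-!
# Crux K1 `CumulativeHeegnerInclusionAtThree` (stmt-BirchSwinnertonDyer-24198), stub A = crux stmt-26896: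
# STRASSMANN'S THEOREM, part 1 — tools and the division step `F(y) - F(x) = (y - x) · G(y)` for a power
# series converging on a closed ball of a complete ultrametric field

Width seat `bsd-line-chl-k1-p1-w2` (g3) of the K1 line `birth` (route `CumulativeHeegnerLeopoldt`, rev 5).
Helper toward stub A (`--supports stmt-BirchSwinnertonDyer-24198`); THEOREMS ONLY (no definition, no named fact,
no `sorry`); pure non-archimedean analysis over any complete nontrivially normed ULTRAMETRIC field `𝕜`. Sequel
(same namespace): `…CumulativeHeegnerInclusionAtThreeStrassmann.lean` — Strassmann's theorem itself and its
open-disc / tempered / `ℂ_p` corollaries, with the motivation (finite exceptional sets `F_ρ` on closed balls for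
the tempered A-line, p624927). BSD is not proved by any of this; no summit statement is proved by this file.

## What is proved (over `𝕜` complete, nontrivially normed, `IsUltrametricDist`)

* §1 tools: `summable_mul_pow` (`‖a_k‖ ρ^k → 0` ⟹ `∑ a_k x^k` converges for `‖x‖ ≤ ρ`: terms `→ 0` suffice),
  `exists_lt_forall_le_of_tendsto_zero` (uniform strictness below a positive level), `norm_add_tsum_eq_of_lt`
  (dominant term), `exists_strassmannIndex` (for `a ≠ 0`: an index `N` with `‖a_k‖ρ^k ≤ ‖a_N‖ρ^N` for all
  `k` and `<` for `k > N` — the Strassmann data).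
* §2 the division step at a point `x` of the ball: the quotient coefficients `b_j = ∑_i a_{j+1+i} x^i` converge
  (`summable_quotientCoeff`), `‖b_j‖ ρ^j ≤ M'/ρ` from `‖a_k‖ρ^k ≤ M'` (`k > j`) (`norm_quotientCoeff_mul_pow_le`),
  `‖b_j‖ ρ^j → 0` (`norm_quotientCoeff_mul_pow_tendsto_zero`); the double family `a_{j+1+i} x^i y^j` is summable
  and regroups by rows / antidiagonals (`hasSum_rows`, `hasSum_antidiagonals`), whence
  **`tsum_sub_tsum_eq_mul_tsum`**: `∑ a_k y^k - ∑ a_k x^k = (y - x) · ∑_j b_j y^j`; and the Strassmann data of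
  `b` sit one index lower (`strassmannData_quotient`: `‖b_N‖ = ‖a_{N+1}‖` by the dominant term).

References: [Cassels1986] J. W. S. Cassels, *Local Fields*, LMS Student Texts 3, CUP 1986, Ch. 4 Thm. 4.1
(Strassmann's theorem) and its proof (division by `X - b`).
-/

noncomputable section

-- D-0017: single-problem summit, `Summit.BirchSwinnertonDyer.BirchSwinnertonDyer.…` repeats a namespace BY DESIGN.
set_option linter.dupNamespace false
set_option autoImplicit false

open scoped Classical Topology

open Filter Finset

namespace Summit.BirchSwinnertonDyer.BirchSwinnertonDyer.Theorems.CumulativeHeegnerInclusionAtThreeStrassmann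

/-! ### §1 Tools -/

section Tools

variable {𝕜 : Type*} [NontriviallyNormedField 𝕜] [IsUltrametricDist 𝕜] [CompleteSpace 𝕜]

omit [IsUltrametricDist 𝕜] [CompleteSpace 𝕜] in
/-- Term bound on the closed ball: `‖a_k x^k‖ ≤ ‖a_k‖ ρ^k` for `‖x‖ ≤ ρ`. [folklore] -/
theorem norm_mul_pow_le {a : ℕ → 𝕜} {ρ : ℝ} {x : 𝕜} (hx : ‖x‖ ≤ ρ) (k : ℕ) :
    ‖a k * x ^ k‖ ≤ ‖a k‖ * ρ ^ k := by
  rw [norm_mul, norm_pow]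
  exact mul_le_mul_of_nonneg_left (pow_le_pow_left₀ (norm_nonneg _) hx k) (norm_nonneg _)

/-- **In a complete ultrametric field a power series converges on the closed ball of radius `ρ` as soon as
`‖a_k‖ ρ^k → 0`** (terms tending to `0` suffice). [cite: Cassels1986, Ch. 4 Lemma 1.1 and Thm. 4.1] -/
theorem summable_mul_pow {a : ℕ → 𝕜} {ρ : ℝ} (ha : Tendsto (fun k ↦ ‖a k‖ * ρ ^ k) atTop (𝓝 0))
    {x : 𝕜} (hx : ‖x‖ ≤ ρ) : Summable fun k ↦ a k * x ^ k := by
  refine NonarchimedeanAddGroup.summable_of_tendsto_cofinite_zero ?_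
  rw [Nat.cofinite_eq_atTop]
  exact squeeze_zero_norm (fun k ↦ norm_mul_pow_le hx k) ha

omit [IsUltrametricDist 𝕜] [CompleteSpace 𝕜] in
/-- **Uniform strictness below a positive level**: if `s_k → 0` and `s_k < M` (`M > 0`) for every `k` with
`P k`, then some `M' < M` bounds all these `s_k` (the finitely many `k` before `s_k ≤ M/2` are handled by a
maximum). [folklore] -/
theorem exists_lt_forall_le_of_tendsto_zero {s : ℕ → ℝ} (hs : Tendsto s atTop (𝓝 0)) {M : ℝ}
    (hM : 0 < M) {P : ℕ → Prop} (h : ∀ k, P k → s k < M) : ∃ M' < M, ∀ k, P k → s k ≤ M' := by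
  obtain ⟨K, hK⟩ : ∃ K, ∀ k ≥ K, s k ≤ M / 2 :=
    eventually_atTop.mp (hs.eventually (eventually_le_nhds (half_pos hM)))
  let T := (Finset.range K).filter P
  by_cases hT : T.Nonempty
  · obtain ⟨k₀, hk₀, hmax⟩ := Finset.exists_max_image T s hT
    refine ⟨max (M / 2) (s k₀), max_lt (half_lt_self hM) (h k₀ (Finset.mem_filter.mp hk₀).2),
      fun k hk ↦ ?_⟩
    by_cases hkK : k < K
    · exact (hmax k (Finset.mem_filter.mpr ⟨Finset.mem_range.mpr hkK, hk⟩)).trans (le_max_right _ _)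
    · exact (hK k (not_lt.mp hkK)).trans (le_max_left _ _)
  · refine ⟨M / 2, half_lt_self hM, fun k hk ↦ ?_⟩
    by_cases hkK : k < K
    · exact absurd ⟨k, Finset.mem_filter.mpr ⟨Finset.mem_range.mpr hkK, hk⟩⟩ hT
    · exact hK k (not_lt.mp hkK)

omit [CompleteSpace 𝕜] in
/-- **Dominant term**: if every term of `g` has norm `≤ M' < ‖u‖`, then `‖u + ∑ g‖ = ‖u‖` (ultrametric
inequality for the sum, then the strict triangle equality). [cite: Cassels1986, Ch. 4 Thm. 4.1 (proof)] -/
theorem norm_add_tsum_eq_of_lt {u : 𝕜} {g : ℕ → 𝕜} {M' : ℝ} (hM' : M' < ‖u‖)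
    (hle : ∀ i, ‖g i‖ ≤ M') : ‖u + ∑' i, g i‖ = ‖u‖ := by
  have ht : ‖∑' i, g i‖ < ‖u‖ := (IsUltrametricDist.norm_tsum_le_of_forall_le hle).trans_lt hM'
  rw [IsUltrametricDist.norm_add_eq_max_of_norm_ne_norm (ne_of_gt ht), max_eq_left ht.le]

omit [IsUltrametricDist 𝕜] [CompleteSpace 𝕜] in
/-- **The Strassmann index exists**: if `‖a_k‖ ρ^k → 0` (`ρ > 0`) and some `a_k ≠ 0`, there is `N` with
`a_N ≠ 0`, `‖a_k‖ ρ^k ≤ ‖a_N‖ ρ^N` for all `k` and `<` for all `k > N` (the LAST index where the maximum is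
attained). [cite: Cassels1986, Ch. 4 Thm. 4.1] -/
theorem exists_strassmannIndex {a : ℕ → 𝕜} {ρ : ℝ} (hρ : 0 < ρ)
    (ha : Tendsto (fun k ↦ ‖a k‖ * ρ ^ k) atTop (𝓝 0)) (hne : ∃ k, a k ≠ 0) :
    ∃ N, a N ≠ 0 ∧ (∀ k, ‖a k‖ * ρ ^ k ≤ ‖a N‖ * ρ ^ N) ∧
      (∀ k, N < k → ‖a k‖ * ρ ^ k < ‖a N‖ * ρ ^ N) := by
  set s : ℕ → ℝ := fun k ↦ ‖a k‖ * ρ ^ k with hs_def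
  obtain ⟨k₀, hk₀⟩ := hne
  have hs0 : 0 < s k₀ := mul_pos (norm_pos_iff.mpr hk₀) (pow_pos hρ _)
  obtain ⟨K, hK⟩ : ∃ K, ∀ k ≥ K, s k < s k₀ :=
    eventually_atTop.mp (ha.eventually (eventually_lt_nhds hs0))
  have hk₀K : k₀ < K := by
    by_contra hh
    exact lt_irrefl _ (hK k₀ (not_lt.mp hh))
  -- a maximiser over `range K` is a global maximiser
  obtain ⟨k₁, hk₁, hmax₁⟩ :=
    Finset.exists_max_image (Finset.range K) s ⟨k₀, Finset.mem_range.mpr hk₀K⟩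
  have hk₀₁ : s k₀ ≤ s k₁ := hmax₁ k₀ (Finset.mem_range.mpr hk₀K)
  have hall : ∀ k, s k ≤ s k₁ := by
    intro k
    by_cases hk : k < K
    · exact hmax₁ k (Finset.mem_range.mpr hk)
    · exact ((hK k (not_lt.mp hk)).trans_le hk₀₁).le
  -- the last index in `range K` attaining the maximum
  set T := (Finset.range K).filter (fun k ↦ s k = s k₁) with hT_def
  have hTne : T.Nonempty := ⟨k₁, Finset.mem_filter.mpr ⟨hk₁, rfl⟩⟩
  set N := T.max' hTne with hN_def
  have hNT : N ∈ T := Finset.max'_mem T hTne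
  have hsN : s N = s k₁ := (Finset.mem_filter.mp hNT).2
  refine ⟨N, ?_, fun k ↦ ?_, fun k hk ↦ ?_⟩
  · have : 0 < s N := by rw [hsN]; exact hs0.trans_le hk₀₁
    intro h0
    rw [hs_def] at this
    simp only [h0, norm_zero, zero_mul, lt_self_iff_false] at this
  · change s k ≤ s N
    rw [hsN]; exact hall k
  · change s k < s N
    rw [hsN]
    rcases (hall k).lt_or_eq with hlt | heq
    · exact hlt
    · exfalso
      by_cases hkK : k < K
      · have hkT : k ∈ T := Finset.mem_filter.mpr ⟨Finset.mem_range.mpr hkK, heq⟩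
        exact absurd (Finset.le_max' T k hkT) (not_le.mpr (hN_def ▸ hk))
      · exact absurd (heq ▸ hK k (not_lt.mp hkK)) (not_lt.mpr hk₀₁)

end Tools

/-! ### §2 The division step `F(y) - F(x) = (y - x) · G(y)` -/

section Division

variable {𝕜 : Type*} [NontriviallyNormedField 𝕜] [IsUltrametricDist 𝕜] [CompleteSpace 𝕜]

/-- The quotient coefficients `b_j = ∑_i a_{j+1+i} x^i` converge for `‖x‖ ≤ ρ` when `‖a_k‖ ρ^k → 0`.
[cite: Cassels1986, Ch. 4 Thm. 4.1 (proof)] -/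
theorem summable_quotientCoeff {a : ℕ → 𝕜} {ρ : ℝ} (hρ : 0 < ρ)
    (ha : Tendsto (fun k ↦ ‖a k‖ * ρ ^ k) atTop (𝓝 0)) {x : 𝕜} (hx : ‖x‖ ≤ ρ) (j : ℕ) :
    Summable fun i ↦ a (j + 1 + i) * x ^ i := by
  -- `‖a_{j+1+i}‖ ρ^i = (‖a_{j+1+i}‖ ρ^{j+1+i}) / ρ^{j+1} → 0`
  refine summable_mul_pow (ρ := ρ) ?_ hx
  have h1 : Tendsto (fun i ↦ ‖a (j + 1 + i)‖ * ρ ^ (j + 1 + i)) atTop (𝓝 0) := by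
    have := ha.comp (tendsto_add_atTop_nat (j + 1))
    refine this.congr fun i ↦ ?_
    simp only [Function.comp_apply]
    rw [add_comm i (j + 1)]
  have h2 := h1.mul_const (ρ ^ (j + 1))⁻¹
  rw [zero_mul] at h2
  refine h2.congr fun i ↦ ?_
  rw [pow_add, mul_comm (ρ ^ (j + 1)) (ρ ^ i), ← mul_assoc, mul_inv_cancel_right₀ (pow_ne_zero _ hρ.ne')]

omit [CompleteSpace 𝕜] in
/-- **Bound on the quotient coefficients**: if `‖a_k‖ ρ^k ≤ M'` for all `k > j`, then
`‖b_j‖ ρ^j ≤ M' / ρ`. [cite: Cassels1986, Ch. 4 Thm. 4.1 (proof)] -/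
theorem norm_quotientCoeff_mul_pow_le {a : ℕ → 𝕜} {ρ : ℝ} (hρ : 0 < ρ) {x : 𝕜} (hx : ‖x‖ ≤ ρ)
    (j : ℕ) {M' : ℝ} (hM' : ∀ k, j < k → ‖a k‖ * ρ ^ k ≤ M') :
    ‖∑' i, a (j + 1 + i) * x ^ i‖ * ρ ^ j ≤ M' / ρ := by
  have hρj : 0 < ρ ^ (j + 1) := pow_pos hρ _
  have hM'0 : 0 ≤ M' := by
    have := hM' (j + 1) (Nat.lt_succ_self j)
    exact (mul_nonneg (norm_nonneg _) (pow_nonneg hρ.le _)).trans this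
  have hterm : ∀ i, ‖a (j + 1 + i) * x ^ i‖ ≤ M' / ρ ^ (j + 1) := by
    intro i
    have hi : ‖a (j + 1 + i) * x ^ i‖ ≤ ‖a (j + 1 + i)‖ * ρ ^ i :=
      norm_mul_pow_le (a := fun i ↦ a (j + 1 + i)) hx i
    refine hi.trans ?_
    rw [le_div_iff₀ hρj]
    calc ‖a (j + 1 + i)‖ * ρ ^ i * ρ ^ (j + 1) = ‖a (j + 1 + i)‖ * ρ ^ (j + 1 + i) := by
          rw [pow_add ρ (j + 1) i]; ring
      _ ≤ M' := hM' _ (by omega)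
  have hsum : ‖∑' i, a (j + 1 + i) * x ^ i‖ ≤ M' / ρ ^ (j + 1) :=
    IsUltrametricDist.norm_tsum_le_of_forall_le_of_nonneg (div_nonneg hM'0 hρj.le) hterm
  calc ‖∑' i, a (j + 1 + i) * x ^ i‖ * ρ ^ j ≤ M' / ρ ^ (j + 1) * ρ ^ j :=
        mul_le_mul_of_nonneg_right hsum (pow_nonneg hρ.le _)
    _ = M' / ρ := by
        rw [pow_succ]
        field_simp

omit [CompleteSpace 𝕜] in
/-- The quotient series again converges on the closed ball: `‖b_j‖ ρ^j → 0`.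
[cite: Cassels1986, Ch. 4 Thm. 4.1 (proof)] -/
theorem norm_quotientCoeff_mul_pow_tendsto_zero {a : ℕ → 𝕜} {ρ : ℝ} (hρ : 0 < ρ)
    (ha : Tendsto (fun k ↦ ‖a k‖ * ρ ^ k) atTop (𝓝 0)) {x : 𝕜} (hx : ‖x‖ ≤ ρ) :
    Tendsto (fun j ↦ ‖∑' i, a (j + 1 + i) * x ^ i‖ * ρ ^ j) atTop (𝓝 0) := by
  rw [Metric.tendsto_atTop]
  intro ε hε
  obtain ⟨K, hK⟩ : ∃ K, ∀ k ≥ K, ‖a k‖ * ρ ^ k ≤ ε / 2 * ρ :=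
    eventually_atTop.mp (ha.eventually (eventually_le_nhds (mul_pos (half_pos hε) hρ)))
  refine ⟨K, fun j hj ↦ ?_⟩
  have hb := norm_quotientCoeff_mul_pow_le hρ hx j (M' := ε / 2 * ρ) fun k hk ↦ hK k (by omega)
  rw [mul_div_assoc, div_self hρ.ne', mul_one] at hb
  rw [Real.dist_eq, sub_zero, abs_of_nonneg (mul_nonneg (norm_nonneg _) (pow_nonneg hρ.le _))]
  exact hb.trans_lt (half_lt_self hε)

omit [IsUltrametricDist 𝕜] [CompleteSpace 𝕜] in
/-- The double family `a_{j+1+i} x^i y^j` (indexed by `(j, i)`) is dominated on the closed ball by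
`‖a_{j+1+i}‖ ρ^{j+1+i} / ρ`. [cite: Cassels1986, Ch. 4 Thm. 4.1 (proof)] -/
theorem norm_doubleFamily_le {a : ℕ → 𝕜} {ρ : ℝ} (hρ : 0 < ρ) {x y : 𝕜} (hx : ‖x‖ ≤ ρ) (hy : ‖y‖ ≤ ρ)
    (q : ℕ × ℕ) :
    ‖a (q.1 + 1 + q.2) * x ^ q.2 * y ^ q.1‖ ≤ ‖a (q.1 + 1 + q.2)‖ * ρ ^ (q.1 + 1 + q.2) / ρ := by
  rw [norm_mul, norm_mul, norm_pow, norm_pow, le_div_iff₀ hρ]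
  have hx2 : ‖x‖ ^ q.2 ≤ ρ ^ q.2 := pow_le_pow_left₀ (norm_nonneg _) hx _
  have hy1 : ‖y‖ ^ q.1 ≤ ρ ^ q.1 := pow_le_pow_left₀ (norm_nonneg _) hy _
  calc ‖a (q.1 + 1 + q.2)‖ * ‖x‖ ^ q.2 * ‖y‖ ^ q.1 * ρ
      ≤ ‖a (q.1 + 1 + q.2)‖ * ρ ^ q.2 * ρ ^ q.1 * ρ := by
        refine mul_le_mul_of_nonneg_right ?_ hρ.le
        exact mul_le_mul (mul_le_mul_of_nonneg_left hx2 (norm_nonneg _)) hy1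
          (pow_nonneg (norm_nonneg _) _) (mul_nonneg (norm_nonneg _) (pow_nonneg hρ.le _))
    _ = ‖a (q.1 + 1 + q.2)‖ * ρ ^ (q.1 + 1 + q.2) := by rw [pow_add, pow_add, pow_one]; ring

/-- The double family `a_{j+1+i} x^i y^j` is summable on the closed ball (its terms tend to `0` along the
cofinite filter of `ℕ × ℕ`). [cite: Cassels1986, Ch. 4 Thm. 4.1 (proof)] -/
theorem summable_doubleFamily {a : ℕ → 𝕜} {ρ : ℝ} (hρ : 0 < ρ)
    (ha : Tendsto (fun k ↦ ‖a k‖ * ρ ^ k) atTop (𝓝 0)) {x y : 𝕜} (hx : ‖x‖ ≤ ρ) (hy : ‖y‖ ≤ ρ) :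
    Summable fun q : ℕ × ℕ ↦ a (q.1 + 1 + q.2) * x ^ q.2 * y ^ q.1 := by
  refine NonarchimedeanAddGroup.summable_of_tendsto_cofinite_zero ?_
  rw [NormedAddGroup.tendsto_nhds_zero]
  intro ε hε
  obtain ⟨K, hK⟩ : ∃ K, ∀ k ≥ K, ‖a k‖ * ρ ^ k < ε * ρ :=
    eventually_atTop.mp (ha.eventually (eventually_lt_nhds (mul_pos hε hρ)))
  rw [Filter.eventually_cofinite]
  refine Set.Finite.subset ((Finset.range K ×ˢ Finset.range K : Finset (ℕ × ℕ)).finite_toSet) ?_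
  intro q hq
  rw [Set.mem_setOf_eq, not_lt] at hq
  rw [Finset.coe_product, Finset.coe_range, Set.mem_prod, Set.mem_Iio, Set.mem_Iio]
  by_contra hcon
  have hK' : K ≤ q.1 + 1 + q.2 := by omega
  have hlt : ‖a (q.1 + 1 + q.2) * x ^ q.2 * y ^ q.1‖ < ε :=
    (norm_doubleFamily_le hρ hx hy q).trans_lt ((div_lt_iff₀ hρ).mpr (hK _ hK'))
  exact absurd (hq.trans_lt hlt) (lt_irrefl _)

/-- Grouping the double family by rows `j`: `∑_{(j,i)} a_{j+1+i} x^i y^j = ∑_j b_j y^j`.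
[cite: Cassels1986, Ch. 4 Thm. 4.1 (proof)] -/
theorem hasSum_rows {a : ℕ → 𝕜} {ρ : ℝ} (hρ : 0 < ρ)
    (ha : Tendsto (fun k ↦ ‖a k‖ * ρ ^ k) atTop (𝓝 0)) {x y : 𝕜} (hx : ‖x‖ ≤ ρ) (hy : ‖y‖ ≤ ρ) :
    HasSum (fun j ↦ (∑' i, a (j + 1 + i) * x ^ i) * y ^ j)
      (∑' q : ℕ × ℕ, a (q.1 + 1 + q.2) * x ^ q.2 * y ^ q.1) := by
  refine (summable_doubleFamily hρ ha hx hy).hasSum.prod_fiberwise fun j ↦ ?_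
  exact (summable_quotientCoeff hρ ha hx j).hasSum.mul_right (y ^ j)

/-- Grouping the double family by antidiagonals `j + i = n`:
`∑_{(j,i)} a_{j+1+i} x^i y^j = ∑_n a_{n+1} ∑_{k ≤ n} y^k x^{n-k}`. [cite: Cassels1986, Ch. 4 Thm. 4.1 (proof)] -/
theorem hasSum_antidiagonals {a : ℕ → 𝕜} {ρ : ℝ} (hρ : 0 < ρ)
    (ha : Tendsto (fun k ↦ ‖a k‖ * ρ ^ k) atTop (𝓝 0)) {x y : 𝕜} (hx : ‖x‖ ≤ ρ) (hy : ‖y‖ ≤ ρ) :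
    HasSum (fun n ↦ a (n + 1) * ∑ k ∈ Finset.range (n + 1), y ^ k * x ^ (n - k))
      (∑' q : ℕ × ℕ, a (q.1 + 1 + q.2) * x ^ q.2 * y ^ q.1) := by
  set f : ℕ × ℕ → 𝕜 := fun q ↦ a (q.1 + 1 + q.2) * x ^ q.2 * y ^ q.1 with hf_def
  have hfs : Summable f := summable_doubleFamily hρ ha hx hy
  set e := (Finset.HasAntidiagonal.sigmaAntidiagonalEquivProd (A := ℕ)) with he
  have hsig : HasSum (f ∘ e) (∑' q, f q) := (Equiv.hasSum_iff e).2 hfs.hasSum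
  refine hsig.sigma fun n ↦ ?_
  have hfin : HasSum (fun q : (antidiagonal n : Finset (ℕ × ℕ)) ↦ (f ∘ e) ⟨n, q⟩)
      (∑ q : (antidiagonal n : Finset (ℕ × ℕ)), (f ∘ e) ⟨n, q⟩) := hasSum_fintype _
  have hval : ∀ q : (antidiagonal n : Finset (ℕ × ℕ)),
      (f ∘ e) ⟨n, q⟩ = a (n + 1) * (y ^ (q : ℕ × ℕ).1 * x ^ (q : ℕ × ℕ).2) := by
    intro q
    have hq : (q : ℕ × ℕ).1 + (q : ℕ × ℕ).2 = n := Finset.HasAntidiagonal.mem_antidiagonal.1 q.2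
    have h1 : (q : ℕ × ℕ).1 + 1 + (q : ℕ × ℕ).2 = n + 1 := by omega
    show f (q : ℕ × ℕ) = _
    rw [hf_def]
    simp only
    rw [h1]
    ring
  have hsumval : ∑ q : (antidiagonal n : Finset (ℕ × ℕ)), (f ∘ e) ⟨n, q⟩ =
      a (n + 1) * ∑ k ∈ Finset.range (n + 1), y ^ k * x ^ (n - k) := by
    rw [Finset.sum_congr rfl (fun q _ ↦ hval q), ← Finset.mul_sum,
      Finset.sum_coe_sort (antidiagonal n) (fun q : ℕ × ℕ ↦ y ^ q.1 * x ^ q.2),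
      Finset.Nat.sum_antidiagonal_eq_sum_range_succ (fun i j ↦ y ^ i * x ^ j)]
  rw [hsumval] at hfin
  exact hfin

/-- **The division identity** `∑_k a_k y^k - ∑_k a_k x^k = (y - x) · ∑_j b_j y^j` on the closed ball
(`‖x‖, ‖y‖ ≤ ρ`), `b_j = ∑_i a_{j+1+i} x^i`: regroup the summable double family `a_{j+1+i} x^i y^j` along
`j + i = n` and use `(y - x) ∑_{k ≤ n} y^k x^{n-k} = y^{n+1} - x^{n+1}`.
[cite: Cassels1986, Ch. 4 Thm. 4.1 (proof)] -/
theorem tsum_sub_tsum_eq_mul_tsum {a : ℕ → 𝕜} {ρ : ℝ} (hρ : 0 < ρ)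
    (ha : Tendsto (fun k ↦ ‖a k‖ * ρ ^ k) atTop (𝓝 0)) {x y : 𝕜} (hx : ‖x‖ ≤ ρ) (hy : ‖y‖ ≤ ρ) :
    ∑' k, a k * y ^ k - ∑' k, a k * x ^ k = (y - x) * ∑' j, (∑' i, a (j + 1 + i) * x ^ i) * y ^ j := by
  have hQ : ∀ n : ℕ, (y - x) * ∑ k ∈ Finset.range (n + 1), y ^ k * x ^ (n - k) = y ^ (n + 1) - x ^ (n + 1) := by
    intro n
    rw [mul_comm]
    have h := geom_sum₂_mul y x (n + 1)
    simpa using h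
  have hsx := summable_mul_pow ha hx
  have hsy := summable_mul_pow ha hy
  have hsx1 : Summable fun n ↦ a (n + 1) * x ^ (n + 1) :=
    (summable_nat_add_iff (f := fun k ↦ a k * x ^ k) 1).mpr hsx
  have hsy1 : Summable fun n ↦ a (n + 1) * y ^ (n + 1) :=
    (summable_nat_add_iff (f := fun k ↦ a k * y ^ k) 1).mpr hsy
  calc ∑' k, a k * y ^ k - ∑' k, a k * x ^ k
      = (a 0 * y ^ 0 + ∑' n, a (n + 1) * y ^ (n + 1)) - (a 0 * x ^ 0 + ∑' n, a (n + 1) * x ^ (n + 1)) := by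
        rw [hsy.tsum_eq_zero_add, hsx.tsum_eq_zero_add]
    _ = ∑' n, (a (n + 1) * y ^ (n + 1) - a (n + 1) * x ^ (n + 1)) := by
        rw [hsy1.tsum_sub hsx1]; ring
    _ = ∑' n, (y - x) * (a (n + 1) * ∑ k ∈ Finset.range (n + 1), y ^ k * x ^ (n - k)) := by
        refine tsum_congr fun n ↦ ?_
        rw [← mul_sub, ← hQ n]; ring
    _ = (y - x) * ∑' n, a (n + 1) * ∑ k ∈ Finset.range (n + 1), y ^ k * x ^ (n - k) := tsum_mul_left
    _ = (y - x) * ∑' j, (∑' i, a (j + 1 + i) * x ^ i) * y ^ j := by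
        rw [(hasSum_antidiagonals hρ ha hx hy).tsum_eq, (hasSum_rows hρ ha hx hy).tsum_eq]

/-- **Strassmann data pass to the quotient with index `N - 1`.** If `‖a_k‖ ρ^k ≤ ‖a_{N+1}‖ ρ^{N+1}` for all
`k`, `<` for `k > N + 1`, `a_{N+1} ≠ 0`, and `x` lies in the ball, then the quotient coefficients
`b_j = ∑_i a_{j+1+i} x^i` satisfy the same at index `N`: `‖b_N‖ = ‖a_{N+1}‖` (dominant term) and
`‖b_j‖ ρ^j ≤ ‖a_{N+1}‖ ρ^N`, `<` for `j > N`. [cite: Cassels1986, Ch. 4 Thm. 4.1 (proof)] -/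
theorem strassmannData_quotient {a : ℕ → 𝕜} {ρ : ℝ} (hρ : 0 < ρ)
    (ha : Tendsto (fun k ↦ ‖a k‖ * ρ ^ k) atTop (𝓝 0)) {N : ℕ} (hN0 : a (N + 1) ≠ 0)
    (hle : ∀ k, ‖a k‖ * ρ ^ k ≤ ‖a (N + 1)‖ * ρ ^ (N + 1))
    (hlt : ∀ k, N + 1 < k → ‖a k‖ * ρ ^ k < ‖a (N + 1)‖ * ρ ^ (N + 1)) {x : 𝕜} (hx : ‖x‖ ≤ ρ) :
    (∑' i, a (N + 1 + i) * x ^ i) ≠ 0 ∧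
    (∀ j, ‖∑' i, a (j + 1 + i) * x ^ i‖ * ρ ^ j ≤ ‖∑' i, a (N + 1 + i) * x ^ i‖ * ρ ^ N) ∧
    (∀ j, N < j → ‖∑' i, a (j + 1 + i) * x ^ i‖ * ρ ^ j < ‖∑' i, a (N + 1 + i) * x ^ i‖ * ρ ^ N) := by
  set M := ‖a (N + 1)‖ * ρ ^ (N + 1) with hM_def
  have hM : 0 < M := mul_pos (norm_pos_iff.mpr hN0) (pow_pos hρ _)
  -- uniform strictness beyond `N + 1`
  obtain ⟨M', hM'M, hM'⟩ := exists_lt_forall_le_of_tendsto_zero ha hM (P := fun k ↦ N + 1 < k) hlt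
  -- the dominant term of `b_N = a_{N+1} + ∑_{i ≥ 1} a_{N+2+i} x^{i+1}`
  have hbN : ‖∑' i, a (N + 1 + i) * x ^ i‖ = ‖a (N + 1)‖ := by
    have hs := summable_quotientCoeff hρ ha hx N
    rw [hs.tsum_eq_zero_add, pow_zero, mul_one, add_zero]
    have hρN : 0 < ρ ^ (N + 1) := pow_pos hρ _
    refine norm_add_tsum_eq_of_lt (M' := M' / ρ ^ (N + 1)) ?_ fun i ↦ ?_
    · rw [div_lt_iff₀ hρN]; exact hM'M
    · have hi : ‖a (N + 1 + (i + 1)) * x ^ (i + 1)‖ ≤ ‖a (N + 1 + (i + 1))‖ * ρ ^ (i + 1) :=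
        norm_mul_pow_le (a := fun i ↦ a (N + 1 + i)) hx (i + 1)
      refine hi.trans ?_
      rw [le_div_iff₀ hρN]
      calc ‖a (N + 1 + (i + 1))‖ * ρ ^ (i + 1) * ρ ^ (N + 1)
          = ‖a (N + 1 + (i + 1))‖ * ρ ^ (N + 1 + (i + 1)) := by rw [pow_add ρ (N + 1) (i + 1)]; ring
        _ ≤ M' := hM' _ (by omega)
  have hbNρ : ‖∑' i, a (N + 1 + i) * x ^ i‖ * ρ ^ N = M / ρ := by
    rw [hbN, hM_def, pow_succ, eq_div_iff hρ.ne']; ring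
  refine ⟨fun h0 ↦ hN0 (norm_eq_zero.mp (hbN ▸ (norm_eq_zero.mpr h0))), fun j ↦ ?_, fun j hj ↦ ?_⟩
  · rw [hbNρ]
    exact norm_quotientCoeff_mul_pow_le hρ hx j fun k _ ↦ hle k
  · rw [hbNρ]
    refine (norm_quotientCoeff_mul_pow_le hρ hx j (M' := M') fun k hk ↦ hM' k (by omega)).trans_lt ?_
    exact div_lt_div_of_pos_right hM'M hρ

end Division

end Summit.BirchSwinnertonDyer.BirchSwinnertonDyer.Theorems.CumulativeHeegnerInclusionAtThreeStrassmann

end
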